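import Literature.AlgebraicGeometry.HodgeTheory.ZeroSchemeSemiregularityMap
import Literature.AlgebraicGeometry.Modules.LineBundleSectionIntegral
import HarnessLib

/-!
# Bloch's semiregularity map for the divisor of a nonzero section of a line bundle on an integral scheme
# (Bloch (1.1) + Hartshorne AG II §7 «(s)₀» — no residual hypothesis)

Layer `Literature/AlgebraicGeometry/HodgeTheory` (literature-typing tranche LT-H1 «semiregularity consumers», cell
`pub-hsemireg`, width seat lit-4 g7, FILE 6). THEOREMS only (plus one `abbrev`), no named fact, no `instance`, no notation,
no `sorry` (D-0026: net debt 0).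

The tree's `HodgeTheory/ZeroSchemeSemiregularityMap` (FILE 4) constructs Bloch's `π : Hⁿ(Z(t), 𝒩_{Z(t)/X}) → Hⁿ⁺¹(X, 𝒪_X)`
(«the semi-regularity map … arises as the boundary map in the cohomology sequence associated to `0 → O_X → O_X(Z) → N → 0`»,
[Bloch1972Semiregularity, (1.1), p. 52]) for the zero scheme of a section `t` of a line bundle under the hypothesis `(h)`
«near every point a frame coordinate of `t` is a non-zero-divisor»; the tree's `Modules/LineBundleSectionIntegral` (FILE 5)
proves `(h)` for `X` INTEGRAL and `t ≠ 0` ([Hartshorne1977, II §7 p. 157]: «let `s ∈ Γ(X, 𝓛)` be a nonzero section … the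
collection `{U, φ(s)}` determines an effective Cartier divisor»). This file composes the two: the classical setting
«`X` an integral (locally Noetherian) scheme, `𝓛` a line bundle, `0 ≠ t ∈ Γ(X, 𝓛)`, `Z = (t)₀`» with NO residual hypothesis.

* `zeroSchemeSemiregularityMapOfNeZero hL1 hL σ₀ t ht n` — `π` for `Z(t)`, `t ≠ 0` on integral `X`
  (`:= zeroSchemeSemiregularityMap hL1 hL t (regular_coord_everywhere_of_isIntegral hL1 σ₀ t ht) n`, an `abbrev`);
* exactness at `Hⁿ(Z(t), 𝒩)` and at `Hⁿ⁺¹(X, 𝒪_X)`; «`Z` semi-regular iff `π` injective» read on the sequence: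
  `π` injective ⟺ `Hⁿ(t) : Hⁿ(X, 𝒪_X) → Hⁿ(X, 𝓛)` onto; **`Hⁿ(X, 𝓛) = 0 ⇒ π` injective** (`n = 1`: «`H¹(X, 𝒪_X(Z)) = 0 ⇒`
  the divisor `Z` is semi-regular», Kodaira–Spencer ∕ Severi); `π` onto ⟺ `Hⁿ⁺¹(t) = 0`; `Hⁿ⁺¹(X, 𝓛) = 0 ⇒ π` onto.

HONEST SCOPE: as FILE 4 — rank one; `X` integral and locally Noetherian; `π` is the divisor-case boundary map, not identified
with the forms-side `IsBlochSemiregular i n 1`; no Hilbert-scheme statement ((1.2) not typed); the identification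
`𝒩 ≅ 𝓛|_{Z(t)}` inside is a chosen witness (FILE 4), all statements choice-invariant.

* Searched (tree + Mathlib pin): FILE 4 (hypothesis `(h)`), FILE 5 (`(h)` on integral schemes); no composed statement. Nothing restated.
-/

noncomputable section

-- `TopCat.Presheaf`/`Scheme.Modules` are not reducible (as in Mathlib's `AlgebraicGeometry/Modules/Sheaf.lean` and the
-- tree's `Motives/ClosedSubschemeRestrictionSequence.lean`).
set_option backward.isDefEq.respectTransparency false

open CategoryTheory Limits Opposite TopologicalSpace Abelian AlgebraicGeometry

universe u

namespace Literature.AlgebraicGeometry.HodgeTheory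

open Literature.AlgebraicGeometry.Modules Literature.AlgebraicGeometry.Motives

variable {X : Scheme.{u}} [IsIntegral X] [IsLocallyNoetherian X] {L : X.Modules} {I : Type u} [Fintype I]
  (hL1 : HasRank L 1) (hL : IsFiniteLocallyFree L) (σ₀ : Fin 1 ≃ I) (t : Γ(L, ⊤)) (ht : t ≠ 0)

/-- **Bloch's `π : Hⁿ(Z(t), 𝒩_{Z(t)/X}) → Hⁿ⁺¹(X, 𝒪_X)` for the divisor of a NONZERO section of a line bundle on an
INTEGRAL scheme** — FILE 4's `zeroSchemeSemiregularityMap` fed with FILE 5's `regular_coord_everywhere_of_isIntegral`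
(«`{U, φ(s)}` determines an effective Cartier divisor»). `n = 1` is Bloch's `π` of (1.1). An `abbrev`.
[cite: Bloch1972Semiregularity, (1.1) Proposition, p. 52] [cite: Hartshorne1977, II §7, p. 157 (the divisor of zeros `(s)₀`)] -/
abbrev zeroSchemeSemiregularityMapOfNeZero (n : ℕ) :
    normalSheafCohomology (zeroSchemeι L t) n →+
      Sheaf.H ((SheafOfModules.toSheaf X.ringCatSheaf).obj (unitModule X)) (n + 1) :=
  zeroSchemeSemiregularityMap hL1 hL t (regular_coord_everywhere_of_isIntegral hL1 σ₀ t ht) n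

/-- **Exactness at `Hⁿ(Z(t), 𝒩)`**: `ker π` = image of the restriction `Hⁿ(X, 𝓛) → Hⁿ(Z(t), 𝒩_{Z(t)/X})`
(«`⋯ → H¹(𝓛) → H¹(𝓛_Y) →^δ H²(𝒪_X) → ⋯`»). [cite: Bloch1972Semiregularity, (1.1) Proposition, p. 52]
[cite: Hartshorne2010, Ex. 6.7 (b), p. 52] -/
theorem exact_restrictNormalCohomology_zeroSchemeSemiregularityMapOfNeZero (n : ℕ) :
    haveI := isClosedImmersion_zeroSchemeι L t
    Function.Exact
      (restrictNormalCohomology (zeroSchemeι L t)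
        (zeroSchemeNormalIso hL1 hL t (regular_coord_everywhere_of_isIntegral hL1 σ₀ t ht)) n)
      (zeroSchemeSemiregularityMapOfNeZero hL1 hL σ₀ t ht n) :=
  exact_restrictNormalCohomology_zeroSchemeSemiregularityMap hL1 hL t _ n

/-- **Exactness at `Hⁿ⁺¹(X, 𝒪_X)`**: the image of `π` is the kernel of `Hⁿ⁺¹(t) : Hⁿ⁺¹(X, 𝒪_X) → Hⁿ⁺¹(X, 𝓛)`.
[cite: Bloch1972Semiregularity, (1.1) Proposition, p. 52] [cite: Hartshorne2010, Ex. 6.7 (b), p. 52] -/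
theorem exact_zeroSchemeSemiregularityMapOfNeZero_mulSectionCohomology (n : ℕ) :
    Function.Exact (zeroSchemeSemiregularityMapOfNeZero hL1 hL σ₀ t ht n) (mulSectionCohomology L t (n + 1)) :=
  exact_zeroSchemeSemiregularityMap_mulSectionCohomology hL1 hL t _ n

/-- **«`Z` is semi-regular iff `π` is injective» for `Z = (t)₀`, `t ≠ 0` on an integral scheme: `π` is injective iff
`Hⁿ(t) : Hⁿ(X, 𝒪_X) → Hⁿ(X, 𝓛)` is surjective** (`n = 1`: `(t)₀` is semi-regular iff `H¹(X, 𝒪_X) → H¹(X, 𝓛)` is onto).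
[cite: Bloch1972Semiregularity, §0 p. 51 (definition) and (1.1) Proposition, p. 52] [cite: Hartshorne1977, II §7, p. 157] -/
theorem zeroSchemeSemiregularityMapOfNeZero_injective_iff (n : ℕ) :
    Function.Injective (zeroSchemeSemiregularityMapOfNeZero hL1 hL σ₀ t ht n) ↔
      Function.Surjective (mulSectionCohomology L t n) :=
  zeroSchemeSemiregularityMap_injective_iff_mulSectionCohomology_surjective hL1 hL t _ n

/-- **`Hⁿ(X, 𝓛) = 0 ⇒ π` injective** — for `n = 1` the classical criterion «if `H¹(X, 𝒪_X(Z)) = 0` then the divisor `Z`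
is semi-regular» (Severi, Kodaira–Spencer; Bloch p. 53), here for `Z = (t)₀` of ANY nonzero section `t` of a line bundle
`𝓛` with `H¹(X, 𝓛) = 0` on an integral scheme. [cite: Bloch1972Semiregularity, (1.1) Proposition, p. 52 and p. 53 lines 1–2]
[cite: Hartshorne1977, II §7, p. 157] -/
theorem zeroSchemeSemiregularityMapOfNeZero_injective_of_subsingleton (n : ℕ)
    [Subsingleton (Sheaf.H ((SheafOfModules.toSheaf X.ringCatSheaf).obj L) n)] :
    Function.Injective (zeroSchemeSemiregularityMapOfNeZero hL1 hL σ₀ t ht n) :=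
  zeroSchemeSemiregularityMap_injective_of_subsingleton hL1 hL t _ n

/-- **`π` is surjective iff `Hⁿ⁺¹(t) : Hⁿ⁺¹(X, 𝒪_X) → Hⁿ⁺¹(X, 𝓛)` is zero.** [cite: Bloch1972Semiregularity, (1.1) Proposition, p. 52]
[cite: Hartshorne2010, Ex. 6.7 (b), p. 52] -/
theorem zeroSchemeSemiregularityMapOfNeZero_surjective_iff (n : ℕ) :
    Function.Surjective (zeroSchemeSemiregularityMapOfNeZero hL1 hL σ₀ t ht n) ↔
      mulSectionCohomology L t (n + 1) = 0 :=
  zeroSchemeSemiregularityMap_surjective_iff hL1 hL t _ n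

/-- **`Hⁿ⁺¹(X, 𝓛) = 0 ⇒ π` surjective.** [cite: Bloch1972Semiregularity, (1.1) Proposition, p. 52]
[cite: Hartshorne2010, Ex. 6.7 (b), p. 52] -/
theorem zeroSchemeSemiregularityMapOfNeZero_surjective_of_subsingleton (n : ℕ)
    [Subsingleton (Sheaf.H ((SheafOfModules.toSheaf X.ringCatSheaf).obj L) (n + 1))] :
    Function.Surjective (zeroSchemeSemiregularityMapOfNeZero hL1 hL σ₀ t ht n) :=
  zeroSchemeSemiregularityMap_surjective_of_subsingleton hL1 hL t _ n

end Literature.AlgebraicGeometry.HodgeTheory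

end
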